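import Literature.Barriers.NavierStokesRegularity.ComplexNavierStokesBlowup
import Mathlib.MeasureTheory.Integral.DominatedConvergence
import Mathlib.MeasureTheory.Integral.Lebesgue.Add
import Mathlib.MeasureTheory.Constructions.BorelSpace.Metric
import Mathlib.Analysis.Normed.Group.Continuity
import Mathlib.Topology.Order.LiminfLimsup
import Mathlib.Topology.Bases
import HarnessLib

/-!
# Li–Sinai complex Navier–Stokes blow-up: the literal "infinite at `t' = t`" form (proofs)

Sibling proof file of `ComplexNavierStokesBlowup.lean` (D-0014). One new named fact, one proved
reduction.

D. Li, Ya. G. Sinai, *Blow ups of complex solutions of the 3D Navier–Stokes system and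
renormalization group method*, J. Eur. Math. Soc. 10 (2008) 267–313, print the blow-up of the
critical member `v_{A_cr}` of their families as (§1, p. 268) "the solution `v_{A_cr}(k, s)` blows
up at `t` so that for `t' < t` both the energy and the enstrophy are finite while at `t' = t` they
both become infinite", and (§10, p. 312, with `A_cr = Λ(t)⁻¹` from the Main Theorem, Thm. 1
p. 311) "`A^p g_p(k, t)` is concentrated in the domain … having the size `O(√p)` and there it
takes values `O(p)`. This immediately implies that at `t` the energy is infinite. … Therefore for
`t' < t` both the energy and the enstrophy are finite."  So in print the solution
`v_A(k,t) = e^{-t|k|²} A v(k,0) + ∫₀ᵗ e^{-(t-s)|k|²} Σ_{p>1} A^p g_p(k,s) ds` (§10, eq. (46)) of the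
integral equation (1) is written, pointwise in `k`, up to and including the blow-up time `t`
(remark, ours: each `g_p(k, ·)` is defined for all times by the recursion (4)–(6) of §2, and since
`supp g_p = C + ⋯ + C` (`p` times) with `C = supp v(·,0)` a small neighbourhood of `(0,0,k⁽⁰⁾)`,
§2 p. 270 and §7 p. 295, only finitely many `p` contribute at a given `k`, so the sum in (46) is
finite for each `k`), its energy is finite at every `t' < t`, and its energy at time `t` itself
is `+∞`.

* `LiSinaiCriticalEnergyBlowup` vendors exactly this literal form (energy only), with the same
  data clauses and the same honest-integral solution notion `SolvesFourierNSAt` as the catalogue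
  fact `ComplexNavierStokesBlowup`, but with the equation (1) holding at every `τ ∈ [0, t]`
  (closed) and the last clause `∫ |v(k,t)|² dk = ∞` in place of `E(τ) → ∞ (τ ↑ t)`.
* `LiSinaiCriticalEnergyBlowup.complexNavierStokesBlowup` PROVES that this literal form implies
  the catalogue fact, i.e. it discharges the "Fatou reading" recorded in scope caveat (b) of
  `ComplexNavierStokesBlowup`: from (1) at `τ = t` the Duhamel term is `e^{-τ|k|²}` times a
  primitive of a function integrable on `[0, t]`, so `τ ↦ v(k, τ)` is continuous on `[0, t]` for
  every `k ≠ 0` (`SolvesFourierNSAt.continuousOn_Icc`); Fatou's lemma along the (countably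
  generated) filter `𝓝[<] t` then gives `∞ = ∫ |v(k,t)|² dk ≤ liminf_{τ ↑ t} E(τ)`.

Status for the catalogue (see the session notes of the fact): the source's proof of either form is
a 47-page renormalisation-group construction whose initial inductive steps (`p ≤ 50`) and
parameter-domain inclusion are computer-numerical (§7 p. 295, p. 302; §9 p. 311, constant 6), so
neither `LiSinaiCriticalEnergyBlowup` nor `ComplexNavierStokesBlowup` is discharged here.

## Audit (D-0021 barrier audit, 2026-08-14) — what Theorem 1 of the source covers (appended)

Reading the source against the two vendored forms (`ComplexNavierStokesBlowup`,
`LiSinaiCriticalEnergyBlowup`):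

* Theorem 1 (§9, p. 311) gives the asymptotics (a₁)–(a₂) of the coefficients `g_p(·, s)` for
  `s` in an interval `S = [S₋, S₊] ⊂ S⁽¹⁾ = [1/(4(k⁽⁰⁾)²), 3/(8(k⁽⁰⁾)²)]` (p. 299) and for
  parameter values "`b_j^{(u)} = b_j^{(u)}(s)`, `b_{j'}^{(n)} = b_{j'}^{(n)}(s)`" DEPENDING ON
  `s` (the ten nested boxes `Δ^{(m)}` shrink in all ten coordinates, p. 310; `l^{(u)} = 4`
  unstable and `l^{(n)} = 6` neutral directions, p. 294). §10 (p. 312) fixes the blow-up time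
  `t ∈ S`, takes the datum with the parameters `b(t)` ("Take `t ∈ [S₋, S₊]` and find the values
  of the parameters … for which the main theorem holds") and `A_cr(t) = Λ(t)⁻¹`, and infers
  `E(t) = ∞` from (a₁)–(a₂) at `s = t` ("This immediately implies that at `t` the energy is
  infinite").
* The second half of the printed sentence, "for `t' < t` both the energy and the enstrophy are
  finite", is inferred in §10 from "the expression for `g_p`" at the time `t'` ("For
  `p ≫ O(1/Δt)` the product `A_cr^p Λ(t')^p` tends exponentially to zero and dominates the
  other terms in the expression for `g_p`"), i.e. from a representation of `g_p(·, t')` with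
  bounded corrections for the datum `b(t)`, which Theorem 1 states for the datum `b(t')` only;
  no estimate uniform in `p` for off-critical parameter values is printed. The rates printed in
  the same paragraph, `E(t') = O(1)/(Δt)⁵` and `Ω(t') = O(1)/(Δt)⁷`, differ from the rates
  `E ∼ C/(τ - t)` (type I), `E ∼ C/(τ - t)^{1/2}` (type II) derived by Boldrighini, Frigio and
  Maponi, IMA J. Appl. Math. 82 (2017) 697–716, §2, where the asymptotics of Theorem 1 is used
  as "the fundamental Ansatz" for one datum at all `s ∈ S`; Boldrighini, Frigio, Maponi,
  Pellegrinotti and Sinai, JETP 131 (2020) 356–360, §1, restate the main result with a smooth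
  cut-off datum, "an open set of the parameters" and a 6-dimensional unstable subspace (the
  source: sharp cut-off (39), p. 295; a parameter point `b(s)`; `l^{(u)} = 4`). Inside the
  proof, p. 304: "We do not discuss the errors which follow from the fact that the expressions
  in the previous formulas depend on `θ₂`", and p. 302: the steps `p ≤ 50` and the choice of
  `ρ₁` are computer-numerical.
* Consequently the clause "finite energy at EVERY `τ < t`" of `LiSinaiCriticalEnergyBlowup` (and
  the `Tendsto` clause of `ComplexNavierStokesBlowup`) records the printed SENTENCE (§1 p. 268,
  §10 p. 312), not a consequence of the printed THEOREM. `LiSinaiCriticalEnergyBlowupNarrow`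
  below keeps what Theorem 1, the first inference of §10 and the small-time convergence of the
  series ("the series (3) converges for sufficiently small `s` and gives a classical solution of
  (1)", §2 p. 270) deliver: equation (1) on `[0, t]`, finite energy on an initial interval
  `[0, t₀)`, infinite energy at `t`. `LiSinaiCriticalEnergyBlowup.narrow` is the trivial
  implication; `LiSinaiCriticalEnergyBlowupNarrow.literal_or_rightAccumulation` PROVES that the
  narrow form gives back the literal form, with blow-up time the infimum `t₁` of the
  infinite-energy times `≥ t₀`, UNLESS the energy is finite on `[0, t₁]` and infinite at times
  `τ ↓ t₁`, `τ > t₁` — the one scenario the informal paragraph of §10 has to exclude. In both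
  cases a finite-energy solution of (1) stops having locally bounded energy at a finite time, so
  the `blocks:` reading of the catalogue entry is unaffected.
* Data class (for the comparison with Clay's data in `blocks:`): the printed data (39) vanish
  outside the ball `A₁ = {|k - κ⁽⁰⁾| ≤ D₁ (k⁽⁰⁾ ln k⁽⁰⁾)^{1/2}}` and are a Gaussian times a
  non-vanishing factor inside (p. 295), hence discontinuous across `∂A₁`; the physical datum
  `u₀ = 𝓕⁻¹(-i v₀)` is entire and lies in every `H^m`, but has only algebraic spatial decay,
  not the rapid decay (4) of Fefferman's statement (A).

## References

* D. Li, Ya. G. Sinai, J. Eur. Math. Soc. 10 (2008) 267–313: §1 p. 268 (eq. (1) and the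
  paragraph on `A_cr`), §2 p. 269–270 (eqs. (3)–(6), `supp g_p`), Thm. 1 p. 311, §10 p. 312.
  [`LiSinai2008`]
* (audit) ibid. §2 p. 270, §6 p. 294, §7 p. 295, p. 299, p. 302, §8 p. 304. [`LiSinai2008`]
* (audit) C. Boldrighini, S. Frigio, P. Maponi, IMA J. Appl. Math. 82 (2017) 697–716, §2
  (arXiv:1702.07139). [`BoldrighiniFrigioMaponi2017`]
* (audit) C. Boldrighini, S. Frigio, P. Maponi, A. Pellegrinotti, Ya. G. Sinai, JETP 131 (2020)
  356–360, §1 (arXiv:1910.13833). [`BoldrighiniEtAl2020`]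
-/

noncomputable section

open MeasureTheory Set Filter Topology
open scoped ENNReal InnerProductSpace RealInnerProductSpace

namespace Literature.Barriers.NavierStokesRegularity

/-- Local notation for Fourier space `ℝ³ = EuclideanSpace ℝ (Fin 3)`. -/
local notation "ℝ³" => EuclideanSpace ℝ (Fin 3)

/-- **Li–Sinai 2008, literal form: energy finite for `t' < t`, infinite at `t' = t`.** There
exist a bounded, measurable, compactly supported real Fourier datum `v₀ : ℝ³ → ℝ³`,
incompressible (`⟨v₀(k), k⟩ = 0`), a time `t > 0` and `v : ℝ → ℝ³ → ℝ³` with `v(0) = v₀`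
solving Li–Sinai's Fourier-side Navier–Stokes integral equation (1) (viscosity `1`, no force,
honest integrals: `SolvesFourierNSAt`) at every `τ` of the CLOSED interval `[0, t]` and every
`k ≠ 0`, with a.e.-measurable slices and finite energy `∫ |v(k,τ)|² dk < ∞` for every
`τ ∈ [0, t)`, and infinite energy `∫ |v(k,t)|² dk = ∞` at `τ = t`. This is the sentence "for
`t' < t` both the energy and the enstrophy are finite while at `t' = t` they both become
infinite" (energy part) for the critical member `v_{A_cr}`, `A_cr = Λ(t)⁻¹`, of a family of the
Main Theorem; the enstrophy clause and the rates `E(t') = O(1)/(Δt)⁵` are not vendored. It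
implies the catalogue fact `ComplexNavierStokesBlowup`
(`LiSinaiCriticalEnergyBlowup.complexNavierStokesBlowup`, proved below); like it, it rests on a
proof with computer-numerical steps (§7 p. 295, p. 302) and an informal last step (§10).
[cite: LiSinai2008, §1 p. 268, Thm. 1 p. 311 and §10 p. 312] -/
def LiSinaiCriticalEnergyBlowup : Prop :=
  ∃ (v₀ : ℝ³ → ℝ³) (t : ℝ) (v : ℝ → ℝ³ → ℝ³), 0 < t ∧
    Measurable v₀ ∧ HasCompactSupport v₀ ∧ (∃ M : ℝ, ∀ k, ‖v₀ k‖ ≤ M) ∧ (∀ k, ⟪v₀ k, k⟫ = 0) ∧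
    v 0 = v₀ ∧
    (∀ τ ∈ Icc 0 t, ∀ k : ℝ³, k ≠ 0 → SolvesFourierNSAt v τ k) ∧
    (∀ τ ∈ Ico 0 t, AEMeasurable (v τ) ∧ ∫⁻ k, ‖v τ k‖ₑ ^ 2 < ∞) ∧
    ∫⁻ k, ‖v t k‖ₑ ^ 2 = ∞

/-- **Time continuity from the integral equation.** If `v` solves Li–Sinai's equation (1) at the
wave vector `k` at every time `τ ∈ [0, t]`, then `τ ↦ v(k, τ)` is continuous on `[0, t]`: by (1),
`v(k,τ) = e^{-τ|k|²} v(k,0) + e^{-τ|k|²} ∫₀^τ e^{s|k|²} F(s) ds` with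
`F(s) = ∫ ⟨v(k-k',s),k⟩ P_k v(k',s) dk'`, and `s ↦ e^{s|k|²} F(s) = e^{t|k|²} · (e^{-(t-s)|k|²} F(s))`
is integrable on `[0, t]` by the interval-integrability clause of `SolvesFourierNSAt` at `τ = t`,
so its primitive is continuous. [folklore] -/
theorem SolvesFourierNSAt.continuousOn_Icc {v : ℝ → ℝ³ → ℝ³} {t : ℝ} {k : ℝ³} (ht : 0 ≤ t)
    (h : ∀ τ ∈ Icc 0 t, SolvesFourierNSAt v τ k) :
    ContinuousOn (fun τ => v τ k) (Icc 0 t) := by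
  set F : ℝ → ℝ³ := fun s => ∫ k', fourierNSIntegrand v s k k' with hF
  set a : ℝ := ‖k‖ ^ 2 with ha
  -- the undamped Duhamel integrand `s ↦ e^{s a} F(s)` is interval integrable on `[0, t]`
  have hint : IntervalIntegrable (fun s => Real.exp (s * a) • F s) volume 0 t := by
    have h1 : IntervalIntegrable (fun s => Real.exp (-(t - s) * a) • F s) volume 0 t :=
      (h t ⟨ht, le_rfl⟩).2.1
    have heq : (Real.exp (t * a) • fun s => Real.exp (-(t - s) * a) • F s) =
        fun s => Real.exp (s * a) • F s := by
      funext s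
      simp only [Pi.smul_apply, smul_smul, ← Real.exp_add]
      congr 1
      ring_nf
    rw [← heq]
    exact h1.smul _
  -- hence its primitive is continuous on `[0, t]`
  have hprim : ContinuousOn (fun τ => ∫ s in (0 : ℝ)..τ, Real.exp (s * a) • F s) (Icc 0 t) := by
    have := intervalIntegral.continuousOn_primitive_interval' hint left_mem_uIcc
    rwa [uIcc_of_le ht] at this
  -- the closed form of `v τ k` given by (1)
  have hform : EqOn (fun τ => v τ k)
      (fun τ => Real.exp (-τ * a) • v 0 k +
        Real.exp (-τ * a) • ∫ s in (0 : ℝ)..τ, Real.exp (s * a) • F s) (Icc 0 t) := by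
    intro τ hτ
    have h3 : v τ k = Real.exp (-τ * a) • v 0 k +
        ∫ s in (0 : ℝ)..τ, Real.exp (-(τ - s) * a) • F s := (h τ hτ).2.2
    have heq : (fun s => Real.exp (-(τ - s) * a) • F s) =
        fun s => Real.exp (-τ * a) • (Real.exp (s * a) • F s) := by
      funext s
      simp only [smul_smul, ← Real.exp_add]
      congr 1
      ring_nf
    simp only
    rw [h3, heq, intervalIntegral.integral_smul]
  refine ContinuousOn.congr ?_ hform
  have hexp : Continuous fun τ : ℝ => Real.exp (-τ * a) := by fun_prop
  exact (hexp.continuousOn.smul continuousOn_const).add (hexp.continuousOn.smul hprim)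

/-- **The literal Li–Sinai statement implies the catalogue barrier fact.** From
`LiSinaiCriticalEnergyBlowup` (equation (1) on the closed interval `[0,t]`, finite energy before
`t`, infinite energy at `t`) one gets `ComplexNavierStokesBlowup` (equation (1) on `[0,t)`,
finite energy before `t`, `E(τ) → ∞` as `τ ↑ t`): for `k ≠ 0`, `v(k,τ) → v(k,t)` as `τ ↑ t`
(`SolvesFourierNSAt.continuousOn_Icc`), `{0}` is Lebesgue-null, and Fatou's lemma along
`𝓝[<] t` gives `∞ = ∫ |v(k,t)|² dk ≤ liminf_{τ ↑ t} ∫ |v(k,τ)|² dk`. [folklore] -/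
theorem LiSinaiCriticalEnergyBlowup.complexNavierStokesBlowup (h : LiSinaiCriticalEnergyBlowup) :
    ComplexNavierStokesBlowup := by
  obtain ⟨v₀, t, v, ht, hmeas, hsupp, hbdd, hdiv, hv0, hsol, hfin, hinf⟩ := h
  refine ⟨v₀, t, v, ht, hmeas, hsupp, hbdd, hdiv, hv0,
    fun τ hτ k hk => hsol τ (Ico_subset_Icc_self hτ) k hk, hfin, ?_⟩
  classical
  -- an auxiliary family, a.e.-measurable for every real `τ`, agreeing with `|v(·,τ)|²` near `t⁻`
  let f : ℝ → ℝ³ → ℝ≥0∞ := fun τ => if τ ∈ Ico 0 t then fun k => ‖v τ k‖ₑ ^ 2 else 0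
  have hf_meas : ∀ τ, AEMeasurable (f τ) volume := by
    intro τ
    by_cases hτ : τ ∈ Ico 0 t
    · simp only [f, if_pos hτ]
      exact ((hfin τ hτ).1.enorm.pow_const 2)
    · simp only [f, if_neg hτ]
      exact aemeasurable_const
  have hIco : ∀ᶠ τ in 𝓝[<] t, τ ∈ Ico 0 t := Ico_mem_nhdsLT ht
  have hfeq : ∀ᶠ τ in 𝓝[<] t, f τ = fun k => ‖v τ k‖ₑ ^ 2 :=
    hIco.mono fun τ hτ => by simp only [f, if_pos hτ]
  -- pointwise: for `k ≠ 0`, `liminf_{τ ↑ t} f τ k = |v(k,t)|²`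
  have hptw : ∀ k : ℝ³, k ≠ 0 → liminf (fun τ => f τ k) (𝓝[<] t) = ‖v t k‖ₑ ^ 2 := by
    intro k hk
    refine Tendsto.liminf_eq ?_
    have hcont : ContinuousOn (fun τ => v τ k) (Icc 0 t) :=
      SolvesFourierNSAt.continuousOn_Icc ht.le fun τ hτ => hsol τ hτ k hk
    have h1 : Tendsto (fun τ => v τ k) (𝓝[<] t) (𝓝 (v t k)) :=
      (hcont t ⟨ht.le, le_rfl⟩).tendsto.mono_left
        (nhdsWithin_le_iff.2 (mem_of_superset hIco Ico_subset_Icc_self))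
    have h2 : Tendsto (fun τ => ‖v τ k‖ₑ ^ 2) (𝓝[<] t) (𝓝 (‖v t k‖ₑ ^ 2)) :=
      ((ENNReal.continuous_pow 2).tendsto _).comp h1.enorm
    refine h2.congr' (hfeq.mono fun τ hτ => ?_)
    simp only [hτ]
  -- `{0}` is null, so the liminf integrand is a.e. `|v(k,t)|²`
  have hae : ∀ᵐ k : ℝ³ ∂volume, k ≠ 0 := by
    have h0 : volume ({0} : Set ℝ³) = 0 := measure_singleton 0
    exact (measure_eq_zero_iff_ae_notMem.1 h0).mono fun k hk => by simpa using hk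
  have hlhs : ∫⁻ k, liminf (fun τ => f τ k) (𝓝[<] t) = ∫⁻ k, ‖v t k‖ₑ ^ 2 :=
    lintegral_congr_ae (hae.mono fun k hk => hptw k hk)
  have hrhs : liminf (fun τ => ∫⁻ k, f τ k) (𝓝[<] t) =
      liminf (fun τ => ∫⁻ k, ‖v τ k‖ₑ ^ 2) (𝓝[<] t) :=
    liminf_congr (hfeq.mono fun τ hτ => by simp only [hτ])
  -- Fatou along `𝓝[<] t`
  have hFatou := lintegral_liminf_le' (μ := (volume : Measure ℝ³)) (u := 𝓝[<] t) hf_meas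
  rw [hlhs, hinf, hrhs] at hFatou
  exact tendsto_of_le_liminf_of_limsup_le hFatou le_top

/-! ## Audit (D-0021): the Theorem-1-backed core and its relation to the literal form -/

/-- **Li–Sinai 2008, Theorem-1-backed core — NARROWED form of `LiSinaiCriticalEnergyBlowup`
(barrier audit, D-0021).** There exist a bounded, measurable, compactly supported real Fourier
datum `v₀ : ℝ³ → ℝ³`, incompressible (`⟨v₀(k), k⟩ = 0`), times `0 < t₀ ≤ t` and
`v : ℝ → ℝ³ → ℝ³` with `v(0) = v₀` solving Li–Sinai's Fourier-side Navier–Stokes integral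
equation (1) with honest integrals (`SolvesFourierNSAt`) at every `τ ∈ [0, t]` and every
`k ≠ 0`, with a.e.-measurable slices on `[0, t)`, FINITE energy `∫ |v(k,τ)|² dk < ∞` on the
initial interval `τ ∈ [0, t₀)`, and INFINITE energy at `τ = t`. This is the literal form with
its clause "finite energy at every `τ < t`" weakened to an initial interval: `t₀` is the
small-time convergence of the power series (3) to a classical solution (§2 p. 270), `t ∈ S` and
the datum `A_cr(t) v(k, 0; b(t))` are those of §10, and `E(t) = ∞` is the first inference of
§10 from Theorem 1 at `s = t`; the finiteness of the energy on the whole of `[0, t)` is NOT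
asserted (see the module docstring, §Audit, for why Theorem 1 does not cover it). Implied by the
literal form (`LiSinaiCriticalEnergyBlowup.narrow`); gives it back up to one explicit scenario
(`LiSinaiCriticalEnergyBlowupNarrow.literal_or_rightAccumulation`).
[cite: LiSinai2008, Thm. 1 p. 311, §10 p. 312 (first paragraph) and §2 p. 270]

BARRIER (structured block, D-0021):
- technique_class: complexification-insensitive fourier-side-algebra energy-sign-blind real-structure-insensitive formal-perturbation-series power-series-in-data
- blocks: NavierStokesRegularity (`Literature.NS.NavierStokesExistenceSmoothR3`) by any argument that would apply verbatim to complex-valued solutions with entire, divergence-free, finite-energy `H^∞` data — i.e. that uses the algebraic/Fourier structure of the nonlinearity and linear (heat-kernel) estimates but no consequence of the real-valuedness of `u` (neither the coercive energy identity nor the conjugation symmetry `û(-k) = conj û(k)` of the spectrum): such an argument would keep the energy of the solution `v` of (1) locally bounded for all times, whereas it is finite on `[0, t₀)` and infinite at `t` [cite: LiSinai2008, Thm. 1 p. 311 and §10 p. 312]; by `LiSinaiCriticalEnergyBlowupNarrow.literal_or_rightAccumulation` there is a time `t₁ ∈ [t₀, t]` before which the energy is finite and at which, or at times accumulating to which from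 above, it is infinite.
- because: for real Fourier data concentrated in a ball around a large wave vector `κ⁽⁰⁾ = (0,0,k⁽⁰⁾)` the coefficient `g_p` of `A^p` in the Duhamel power series is supported in `C + ⋯ + C` (`p` summands), around `p κ⁽⁰⁾` with transversal size `O(√p)` [cite: LiSinai2008, §2 p. 270]; in the rescaled variable `Y` the recursion for `g̃_p` becomes a renormalisation-group map with a Gaussian–Hermite fixed point `H⁽⁰⁾`, 4 unstable and 6 neutral directions [cite: LiSinai2008, §3–§6 (p. 294)], and for a 10-parameter family of data tuned to the stable manifold one gets `g̃_p(Y, s) = p Z(s) Λ(s)^p e^{-|Y|²/2} (H⁽⁰⁾ + o(1))` with `Λ` strictly increasing on `S` [cite: LiSinai2008, Thm. 1 p. 311]; at `A = Λ(t)⁻¹` the modes `A^p g_p(·, t)` have size `O(p)` on balls of size `O(√p)`, all with the sign pattern of `H⁽⁰⁾`, so the energy at `t` is infinite [cite: LiSinai2008, §10 p. 312].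
- evasions_known: use real-valuedness — for real solutions the energy inequality is coercive ("For such solutions the energy inequality does not hold") [cite: LiSinai2008, §1 p. 268], though an energy identity alone is not enough (averaged real models obeying it blow up) [cite: Tao2016AveragedNS, §1.1 Thm. 1.5]; (audit) real-valuedness can also enter through the TWO-SIDEDNESS of the spectrum: the blow-up datum and all `g_p` live in a cone around the positive `k₃`-axis (p. 270, p. 295), impossible for a real field (`v` odd), and for the antisymmetrised real data the cascade terms are centred at `ℓ κ⁽⁰⁾` with `|ℓ| = O(√p)` instead of `p κ⁽⁰⁾` and no blow-up is seen numerically [cite: BoldrighiniEtAl2020, §1 and §3], while the existence of a real renormalisation-group fixed point "remains unclear" [cite: LiSinai2008, §1 p. 269]; related non-coercive models: [cite: MontgomerySmith2001, Thm. 1], [cite: LemarieRieusset2016, §11.2 p. 313].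
- scope_caveats: (a) `E(t) = ∞` is itself a one-line inference in print from Theorem 1 at `s = t` [cite: LiSinai2008, §10 p. 312]; (b) NOT kept from the printed sentence: finite energy at every `τ < t`, the enstrophy, the rates — in print the finiteness for `τ < t` is argued from a representation of `g_p(·, τ)` for the `t`-critical datum which Theorem 1 (parameter values `b(s)` depending on `s`, p. 311; datum chosen after `t`, p. 312) does not provide, and the printed rates `(Δt)⁻⁵`, `(Δt)⁻⁷` disagree with `C/(τ - t)`, `C/(τ - t)^{1/2}` [cite: BoldrighiniFrigioMaponi2017, §2]; what separates the narrow from the literal form is exactly the second disjunct of `…literal_or_rightAccumulation`; (c) blow-up times lie in `S ⊂ [1/(4(k⁽⁰⁾)²), 3/(8(k⁽⁰⁾)²)]` with `k⁽⁰⁾` large [cite: LiSinai2008, §7 p. 299]; (d) the printed data (39) vanish outside `A₁` with a non-vanishing Gaussian factor on `∂A₁` [cite: LiSinai2008, §7 p. 295]: physical data entire, `H^∞`, finite energy, but with algebraic rather than rapid spatial decay — the comparison with Clay's Schwartz-type data in `blocks:` holds up to this; a follow-up restates the result with a smooth cut-off, an open set of parameters and 6 unstable directions without comment [cite: BoldrighiniEtAl2020,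 §1]; (e) computer-numerical steps without stated error control (`p ≤ 50`, the choice of `ρ₁`) [cite: LiSinai2008, §7 p. 302] and an undiscussed remainder ("We do not discuss the errors which follow from the fact that the expressions in the previous formulas depend on `θ₂`") [cite: LiSinai2008, §8 p. 304]; (f) Fourier side only; the normalisation of (1) and `û = -iv` are the authors' [cite: LiSinai2008, §1 p. 268]; (g) the side conditions (honest integrals, a.e.-measurability) are extra conjuncts satisfied by the power-series solution, which at each `k` is a finite sum of bounded compactly supported modes [cite: LiSinai2008, §2 p. 270].
- status: established in the sense of the source — Theorem 1 with the computer-numerical steps of caveat (e) plus the one-line inference (a); not discharged here. -/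
def LiSinaiCriticalEnergyBlowupNarrow : Prop :=
  ∃ (v₀ : ℝ³ → ℝ³) (t₀ t : ℝ) (v : ℝ → ℝ³ → ℝ³), 0 < t₀ ∧ t₀ ≤ t ∧
    Measurable v₀ ∧ HasCompactSupport v₀ ∧ (∃ M : ℝ, ∀ k, ‖v₀ k‖ ≤ M) ∧ (∀ k, ⟪v₀ k, k⟫ = 0) ∧
    v 0 = v₀ ∧
    (∀ τ ∈ Icc 0 t, ∀ k : ℝ³, k ≠ 0 → SolvesFourierNSAt v τ k) ∧
    (∀ τ ∈ Ico 0 t, AEMeasurable (v τ)) ∧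
    (∀ τ ∈ Ico 0 t₀, ∫⁻ k, ‖v τ k‖ₑ ^ 2 < ∞) ∧
    ∫⁻ k, ‖v t k‖ₑ ^ 2 = ∞

/-- **The literal form implies the narrowed form** (take `t₀ = t`). [folklore] -/
theorem LiSinaiCriticalEnergyBlowup.narrow (h : LiSinaiCriticalEnergyBlowup) :
    LiSinaiCriticalEnergyBlowupNarrow := by
  obtain ⟨v₀, t, v, ht, hmeas, hsupp, hbdd, hdiv, hv0, hsol, hfin, hinf⟩ := h
  exact ⟨v₀, t, t, v, ht, le_rfl, hmeas, hsupp, hbdd, hdiv, hv0, hsol,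
    fun τ hτ => (hfin τ hτ).1, fun τ hτ => (hfin τ hτ).2, hinf⟩

/-- **What separates the narrowed form from the literal one.** From
`LiSinaiCriticalEnergyBlowupNarrow` let `t₁ = inf {τ ∈ [t₀, t] : ∫ |v(k,τ)|² dk = ∞}` (a
non-empty set containing `t`). The energy is finite on `[0, t₁)`, and EITHER it is infinite
at `t₁` — then `(v₀, t₁, v)` witnesses the literal form `LiSinaiCriticalEnergyBlowup` (equation
(1) on `[0, t₁]`, finite energy before, infinite energy at `t₁`) — OR it is finite on all of
`[0, t₁]` while every interval `(t₁, t₁ + η)` contains a time of infinite energy (at which (1)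
still holds on `[0, τ]`). The second disjunct is the scenario that the informal "for `t' < t`
the energy is finite" of the source (§10 p. 312) has to rule out; real analysis alone does not.
[folklore] -/
theorem LiSinaiCriticalEnergyBlowupNarrow.literal_or_rightAccumulation
    (h : LiSinaiCriticalEnergyBlowupNarrow) :
    LiSinaiCriticalEnergyBlowup ∨
      ∃ (v₀ : ℝ³ → ℝ³) (t₁ : ℝ) (v : ℝ → ℝ³ → ℝ³), 0 < t₁ ∧
        Measurable v₀ ∧ HasCompactSupport v₀ ∧ (∃ M : ℝ, ∀ k, ‖v₀ k‖ ≤ M) ∧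
        (∀ k, ⟪v₀ k, k⟫ = 0) ∧ v 0 = v₀ ∧
        (∀ τ ∈ Icc 0 t₁, ∀ k : ℝ³, k ≠ 0 → SolvesFourierNSAt v τ k) ∧
        (∀ τ ∈ Icc 0 t₁, AEMeasurable (v τ) ∧ ∫⁻ k, ‖v τ k‖ₑ ^ 2 < ∞) ∧
        ∀ η : ℝ, 0 < η → ∃ τ ∈ Ioo t₁ (t₁ + η),
          (∀ σ ∈ Icc 0 τ, ∀ k : ℝ³, k ≠ 0 → SolvesFourierNSAt v σ k) ∧
          ∫⁻ k, ‖v τ k‖ₑ ^ 2 = ∞ := by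
  obtain ⟨v₀, t₀, t, v, ht₀, ht₀t, hmeas, hsupp, hbdd, hdiv, hv0, hsol, haem, hfin, hinf⟩ := h
  classical
  -- the set of infinite-energy times in `[t₀, t]` and its infimum `t₁`
  set S : Set ℝ := {τ | τ ∈ Icc t₀ t ∧ ∫⁻ k, ‖v τ k‖ₑ ^ 2 = ∞} with hS
  have htS : t ∈ S := ⟨⟨ht₀t, le_rfl⟩, hinf⟩
  have hSne : S.Nonempty := ⟨t, htS⟩
  have hSbdd : BddBelow S := ⟨t₀, fun τ hτ => hτ.1.1⟩
  set t₁ : ℝ := sInf S with ht₁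
  have ht₀t₁ : t₀ ≤ t₁ := le_csInf hSne fun τ hτ => hτ.1.1
  have ht₁t : t₁ ≤ t := csInf_le hSbdd htS
  have ht₁pos : 0 < t₁ := ht₀.trans_le ht₀t₁
  -- finite energy strictly before `t₁`
  have hfin' : ∀ τ ∈ Ico 0 t₁, ∫⁻ k, ‖v τ k‖ₑ ^ 2 < ∞ := by
    intro τ hτ
    by_cases hτ₀ : τ < t₀
    · exact hfin τ ⟨hτ.1, hτ₀⟩
    · have hnot : τ ∉ S := notMem_of_lt_csInf hτ.2 hSbdd
      have hne : ∫⁻ k, ‖v τ k‖ₑ ^ 2 ≠ ∞ := fun h' =>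
        hnot ⟨⟨not_lt.1 hτ₀, hτ.2.le.trans ht₁t⟩, h'⟩
      exact lt_top_iff_ne_top.2 hne
  -- infinite-energy times `≥ t₁` arbitrarily close to `t₁`
  have hacc : ∀ η : ℝ, 0 < η → ∃ τ ∈ S, τ < t₁ + η := fun η hη =>
    exists_lt_of_csInf_lt hSne (by linarith)
  by_cases hcase : ∫⁻ k, ‖v t₁ k‖ₑ ^ 2 = ∞
  · -- the literal form holds with blow-up time `t₁`
    left
    refine ⟨v₀, t₁, v, ht₁pos, hmeas, hsupp, hbdd, hdiv, hv0, ?_, ?_, hcase⟩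
    · intro τ hτ k hk
      exact hsol τ ⟨hτ.1, hτ.2.trans ht₁t⟩ k hk
    · intro τ hτ
      exact ⟨haem τ ⟨hτ.1, hτ.2.trans_le ht₁t⟩, hfin' τ hτ⟩
  · -- energy finite on `[0, t₁]`, infinite at times `τ ↓ t₁`, `τ > t₁`
    right
    have ht₁t' : t₁ < t := lt_of_le_of_ne ht₁t fun h' => hcase (h' ▸ hinf)
    refine ⟨v₀, t₁, v, ht₁pos, hmeas, hsupp, hbdd, hdiv, hv0, ?_, ?_, ?_⟩
    · intro τ hτ k hk
      exact hsol τ ⟨hτ.1, hτ.2.trans ht₁t⟩ k hk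
    · intro τ hτ
      refine ⟨haem τ ⟨hτ.1, hτ.2.trans_lt ht₁t'⟩, ?_⟩
      rcases hτ.2.lt_or_eq with hlt | heq
      · exact hfin' τ ⟨hτ.1, hlt⟩
      · rw [heq]; exact lt_top_iff_ne_top.2 hcase
    · intro η hη
      obtain ⟨τ, hτS, hτlt⟩ := hacc η hη
      have hτge : t₁ ≤ τ := csInf_le hSbdd hτS
      have hτne : τ ≠ t₁ := fun h' => hcase (h' ▸ hτS.2)
      refine ⟨τ, ⟨lt_of_le_of_ne hτge (Ne.symm hτne), hτlt⟩, ?_, hτS.2⟩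
      intro σ hσ k hk
      exact hsol σ ⟨hσ.1, hσ.2.trans hτS.1.2⟩ k hk

end Literature.Barriers.NavierStokesRegularity
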